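import Mathlib
import Summits.NavierStokesRegularity.NavierStokesRegularity.Theses.LandauTail
import Literature.Analysis.FluidPDE.ClassicalSolutionRescale
import Literature.Analysis.FluidPDE.ConstantinDirectionDissipationProofs

/-!
# NavierStokesRegularity — route `LandauTail`, crux `LandauTailBlowup`: the birth cut is tight

Helper file for the crux item `stmt-NavierStokesRegularity-1944` (`LandauTail.LandauTailBlowup`, line
`registered` = `Cruxes/LandauTailBlowup/Lines/birth.lean`, cut `X ⇐ LandauTailLocal ∧ LandauTailTransfer`).
It proves, sorry-free, the CONVERSE of the cut:

* `landauTailLocal_of_landauTailBlowup : LandauTailBlowup → LandauTailLocal` — a Clay-data classical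
  Leray–Hopf solution with a parabolic-scale Landau tail at `(xs, T)` yields, after the viscosity-normalising
  parabolic zoom `w(s, y) = (√T/√ν) u(T + T s, xs + √ν √T y)` (viscosity `ν ↦ 1`, `(T, xs) ↦ (0, 0)`,
  profile `U ↦ ν⁻¹ U`, `P ↦ ν⁻² P`), a local-energy-class Landau-tailed first singularity at the origin:
  the Tsai local energy bounds on `B₁ × (-1, 0)` come from the Leray–Hopf energy inequality
  (`sup_t ∫ |u(t)|² ≤ 2 E(u₀)`) and from the identification of the Leray–Hopf weak gradient with the
  classical gradient (`IsLerayHopfOn.lintegral_frobeniusNormSq_fderiv_of_classical`: `∫₀ᵀ∫ |∇u|² < ∞`),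
  transported by the change of variables `(t, x) = (T + T s, xs + γ y)`;
* `landauTailTransfer_of_landauTailBlowup : LandauTailBlowup → LandauTailTransfer` (trivial: `X → (L → X)`);
* `landauTailBlowup_iff_local_and_transfer : LandauTailBlowup ↔ LandauTailLocal ∧ LandauTailTransfer` — the
  route's layer-1 cut of its target (items stmt-…-1946, 1948 ⊢ 1944) loses nothing;
* `not_landauTailBlowup_of_not_landauTailLocal : ¬ LandauTailLocal → ¬ LandauTailBlowup` — a Liouville
  theorem for Landau-tailed first singularities in the local class (the refutation of item 1946) refutes
  the crux.

References: J. Leray, Acta Math. 63 (1934), §20 (similarity transformation); L. Caffarelli, R. Kohn,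
L. Nirenberg, CPAM 35 (1982), (1.5)–(1.6); T.-P. Tsai, ARMA 143 (1998), Thm 2 (the local energy class);
V. Šverák, arXiv:math/0604550 (Landau solutions as the homogeneous steady states).
-/

noncomputable section

open Filter Set Topology MeasureTheory Metric
open scoped ENNReal NNReal
open Literature.Analysis.FluidPDE

-- the summit-side namespace repeats a component by design (D-0017)
set_option linter.dupNamespace false

namespace Summit.NavierStokesRegularity.NavierStokesRegularity.Theorems

/-- **Viscosity scaling of the Landau profile class.** If `(U, P)` is smooth off the origin and solves
the steady Navier–Stokes system `(U·∇)U + ∇P = ν ΔU`, `div U = 0` off the origin with viscosity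
`ν > 0`, is homogeneous of degree `-1` and nonzero, then `(ν⁻¹ U, ν⁻² P)` has the same properties
with viscosity `1` (every term of the equation at `x` scales by `ν⁻²`). [folklore] -/
theorem landauTail_profile_viscosity_one {ν : ℝ} (hν : 0 < ν)
    {U : EuclideanSpace ℝ (Fin 3) → EuclideanSpace ℝ (Fin 3)} {P : EuclideanSpace ℝ (Fin 3) → ℝ}
    (hU : ContDiffOn ℝ (⊤ : ℕ∞) U {0}ᶜ) (hP : ContDiffOn ℝ (⊤ : ℕ∞) P {0}ᶜ)
    (hNS : ∀ x : EuclideanSpace ℝ (Fin 3), x ≠ 0 →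
      convect U U x + gradient P x = ν • Laplacian.laplacian U x)
    (hdiv : ∀ x : EuclideanSpace ℝ (Fin 3), x ≠ 0 → VectorCalculus.divergence U x = 0)
    (hhom : ∀ c : ℝ, 0 < c → ∀ x : EuclideanSpace ℝ (Fin 3), U (c • x) = c⁻¹ • U x)
    (hne : ∃ x : EuclideanSpace ℝ (Fin 3), U x ≠ 0) :
    ContDiffOn ℝ (⊤ : ℕ∞) (fun x => ν⁻¹ • U x) {0}ᶜ ∧
    ContDiffOn ℝ (⊤ : ℕ∞) (fun x => (ν⁻¹) ^ 2 * P x) {0}ᶜ ∧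
    (∀ x : EuclideanSpace ℝ (Fin 3), x ≠ 0 →
      convect (fun x => ν⁻¹ • U x) (fun x => ν⁻¹ • U x) x + gradient (fun x => (ν⁻¹) ^ 2 * P x) x =
        (1 : ℝ) • Laplacian.laplacian (fun x => ν⁻¹ • U x) x) ∧
    (∀ x : EuclideanSpace ℝ (Fin 3), x ≠ 0 → VectorCalculus.divergence (fun x => ν⁻¹ • U x) x = 0) ∧
    (∀ c : ℝ, 0 < c → ∀ x : EuclideanSpace ℝ (Fin 3),
      (fun x => ν⁻¹ • U x) (c • x) = c⁻¹ • (fun x => ν⁻¹ • U x) x) ∧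
    (∃ x : EuclideanSpace ℝ (Fin 3), (fun x => ν⁻¹ • U x) x ≠ 0) := by
  have hν0 : ν ≠ 0 := hν.ne'
  refine ⟨hU.const_smul ν⁻¹, contDiffOn_const.mul hP, ?_, ?_, ?_, ?_⟩
  · intro x hx
    have hxmem : ({0}ᶜ : Set (EuclideanSpace ℝ (Fin 3))) ∈ 𝓝 x := isOpen_compl_singleton.mem_nhds hx
    have hUd : DifferentiableAt ℝ U x := (hU.differentiableOn (by simp)).differentiableAt hxmem
    have hPd : DifferentiableAt ℝ P x := (hP.differentiableOn (by simp)).differentiableAt hxmem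
    have hU2 : ContDiffAt ℝ 2 U x :=
      ((hU.of_le (by norm_cast)).contDiffAt hxmem)
    -- convective term
    have hconv : convect (fun x => ν⁻¹ • U x) (fun x => ν⁻¹ • U x) x = (ν⁻¹ * ν⁻¹) • convect U U x := by
      simp only [convect_apply]
      rw [fderiv_fun_const_smul hUd, FunLike.coe_smul, Pi.smul_apply, map_smul, smul_smul]
    -- pressure gradient
    have hgrad : gradient (fun x => (ν⁻¹) ^ 2 * P x) x = (ν⁻¹ * ν⁻¹) • gradient P x := by
      have := gradient_const_smul hPd ((ν⁻¹) ^ 2)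
      simp only [smul_eq_mul] at this
      rw [this, sq]
    -- Laplacian
    have hlap : Laplacian.laplacian (fun x => ν⁻¹ • U x) x = ν⁻¹ • Laplacian.laplacian U x := by
      have := InnerProductSpace.laplacian_smul ν⁻¹ hU2
      exact this
    rw [hconv, hgrad, hlap, ← smul_add, hNS x hx, smul_smul, smul_smul, one_mul]
    congr 1
    field_simp
  · intro x hx
    have hxmem : ({0}ᶜ : Set (EuclideanSpace ℝ (Fin 3))) ∈ 𝓝 x := isOpen_compl_singleton.mem_nhds hx
    have hUd : DifferentiableAt ℝ U x := (hU.differentiableOn (by simp)).differentiableAt hxmem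
    rw [divergence_const_smul_apply hUd, hdiv x hx, mul_zero]
  · intro c hc x
    simp only
    rw [hhom c hc x, smul_comm]
  · obtain ⟨x, hx⟩ := hne
    exact ⟨x, by simpa [smul_eq_zero, hν0] using hx⟩

/-! ### The viscosity-normalising parabolic zoom about `(T, xs)` -/

/-- **The zoom solves the unit-viscosity system on `ℝ³ × (-1, 0)`.** For a classical solution
`(u, p)` of the unforced Navier–Stokes system with viscosity `ν > 0` on `[0, T)`, `T > 0`, the pair
`w(s, y) = (√T/√ν) u(T + T s, xs + √ν√T y)`, `q = (√T/√ν)² p(…)` is a classical solution of the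
unforced unit-viscosity system on `(-1, 0)` (Leray's similarity transformation combined with the
viscosity scaling: `IsClassicalNSSolutionOn.stRescale` with `α = √T/√ν`, `γ = √ν√T`, `β = T`;
Leray 1934, §20; CKN 1982, (1.5)–(1.6)). [cite: Leray1934, §20] -/
theorem landauTail_zoom_isClassicalNSSolutionOn {ν T : ℝ} (hν : 0 < ν) (hT : 0 < T)
    {u : ℝ → EuclideanSpace ℝ (Fin 3) → EuclideanSpace ℝ (Fin 3)} {p : ℝ → EuclideanSpace ℝ (Fin 3) → ℝ}
    (hcl : IsClassicalNSSolutionOn (Ico 0 T) ν 0 u p) (xs : EuclideanSpace ℝ (Fin 3)) :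
    IsClassicalNSSolutionOn (Ioo (-1) 0) 1 0
      ((Real.sqrt T / Real.sqrt ν) • stPull T (Real.sqrt ν * Real.sqrt T) T xs u)
      ((Real.sqrt T / Real.sqrt ν) ^ 2 • stPull T (Real.sqrt ν * Real.sqrt T) T xs p) := by
  have hsν : 0 < Real.sqrt ν := Real.sqrt_pos.2 hν
  have hsT : 0 < Real.sqrt T := Real.sqrt_pos.2 hT
  have hνν : Real.sqrt ν * Real.sqrt ν = ν := Real.mul_self_sqrt hν.le
  have hTT : Real.sqrt T * Real.sqrt T = T := Real.mul_self_sqrt hT.le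
  have hα : 0 < Real.sqrt T / Real.sqrt ν := div_pos hsT hsν
  have hγ : 0 < Real.sqrt ν * Real.sqrt T := mul_pos hsν hsT
  have hβ : T = Real.sqrt T / Real.sqrt ν * (Real.sqrt ν * Real.sqrt T) := by
    field_simp
    linarith [hTT]
  have key := hcl.stRescale hα hγ hβ T xs
  have hvisc : Real.sqrt T / Real.sqrt ν * ν / (Real.sqrt ν * Real.sqrt T) = 1 := by
    field_simp
    linarith [hνν]
  have hS : ((fun r => T + T * r) ⁻¹' Ico 0 T) = Ico (-1) 0 := by
    ext r
    simp only [mem_preimage, mem_Ico]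
    constructor
    · rintro ⟨h1, h2⟩
      constructor <;> nlinarith
    · rintro ⟨h1, h2⟩
      constructor <;> nlinarith
  rw [hvisc, smul_stPull_zero, hS] at key
  exact key.mono Ioo_subset_Ico_self (uniqueDiffOn_Ioo (-1) 0)

/-- **Local energy of the zoom.** If `u` is Leray–Hopf on `[0, T]` (unforced, `ν > 0`), the zoom
`w(s, ·) = (√T/√ν) u(T + T s, xs + √ν√T ·)` has `∫_{B₁} |w(s)|² ≤ C` for every `s ∈ (-1, 0)`, with
`C = (T/ν) · (√ν√T)⁻³ · 2E(u₀)`: enlarge `B₁` to `ℝ³`, change variables `x = xs + γ y`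
(`lintegral_comp_space_affine`) and use the energy inequality from `0` (dissipation dropped). [folklore] -/
theorem landauTail_zoom_energy {ν T : ℝ} (hν : 0 < ν) (hT : 0 < T)
    {u : ℝ → EuclideanSpace ℝ (Fin 3) → EuclideanSpace ℝ (Fin 3)} (hLH : IsLerayHopfOn T ν 0 (u 0) u)
    (xs : EuclideanSpace ℝ (Fin 3)) :
    ∃ C : ℝ≥0, ∀ s ∈ Ioo (-1 : ℝ) 0, ∫⁻ y in ball (0 : EuclideanSpace ℝ (Fin 3)) 1,
      ‖((Real.sqrt T / Real.sqrt ν) • stPull T (Real.sqrt ν * Real.sqrt T) T xs u) s y‖ₑ ^ 2 ≤ C := by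
  have hsν : 0 < Real.sqrt ν := Real.sqrt_pos.2 hν
  have hsT : 0 < Real.sqrt T := Real.sqrt_pos.2 hT
  set α : ℝ := Real.sqrt T / Real.sqrt ν with hαdef
  set γ : ℝ := Real.sqrt ν * Real.sqrt T with hγdef
  have hα : 0 < α := div_pos hsT hsν
  have hγ : 0 < γ := mul_pos hsν hsT
  set K : ℝ := VectorCalculus.kineticEnergy (u 0) with hK
  have hK0 : 0 ≤ K := kineticEnergy_nonneg _
  refine ⟨(α ^ 2 * ((γ ^ 3)⁻¹ * (2 * K))).toNNReal, fun s hs => ?_⟩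
  have ht : T + T * s ∈ Icc 0 T := ⟨by nlinarith [hs.1], by nlinarith [hs.2]⟩
  -- energy inequality from `0`, dissipation dropped
  have hE : eEnergy (u (T + T * s)) ≤ ENNReal.ofReal (2 * K) := by
    obtain ⟨G, -, -, hE0, -⟩ := hLH.weakGrad_energy
    have h1 := hE0 (T + T * s) ht
    simp only [Pi.zero_apply, inner_zero_left, integral_zero, intervalIntegral.integral_zero,
      add_zero] at h1
    have hD : 0 ≤ ν * (∫⁻ τ in Ioo 0 (T + T * s), ∫⁻ x,
        ENNReal.ofReal (frobeniusNormSq (G τ x))).toReal := mul_nonneg hν.le ENNReal.toReal_nonneg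
    rw [eEnergy_eq_ofReal _ (hLH.memLp _ ht)]
    exact ENNReal.ofReal_le_ofReal (by linarith)
  have hα2 : ‖α‖ₑ ^ 2 ≠ ∞ := ENNReal.pow_ne_top enorm_ne_top
  have hfinal : ‖α‖ₑ ^ 2 * (ENNReal.ofReal (γ ^ 3)⁻¹ * ENNReal.ofReal (2 * K)) =
      ((α ^ 2 * ((γ ^ 3)⁻¹ * (2 * K))).toNNReal : ℝ≥0∞) := by
    rw [Real.enorm_eq_ofReal hα.le, ← ENNReal.ofReal_pow hα.le,
      ← ENNReal.ofReal_mul (by positivity), ← ENNReal.ofReal_mul (by positivity)]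
    rfl
  rw [← hfinal]
  calc ∫⁻ y in ball (0 : EuclideanSpace ℝ (Fin 3)) 1, ‖(α • stPull T γ T xs u) s y‖ₑ ^ 2
      ≤ ∫⁻ y, ‖(α • stPull T γ T xs u) s y‖ₑ ^ 2 := setLIntegral_le_lintegral _ _
    _ = ∫⁻ y, ‖α‖ₑ ^ 2 * ‖u (T + T * s) (xs + γ • y)‖ₑ ^ 2 := by
        refine lintegral_congr fun y => ?_
        rw [smul_stPull_apply, enorm_smul, mul_pow]
    _ = ‖α‖ₑ ^ 2 * ∫⁻ y, ‖u (T + T * s) (xs + γ • y)‖ₑ ^ 2 := lintegral_const_mul' _ _ hα2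
    _ = ‖α‖ₑ ^ 2 * (ENNReal.ofReal (γ ^ 3)⁻¹ * eEnergy (u (T + T * s))) := by
        rw [lintegral_comp_space_affine hγ xs (fun x => ‖u (T + T * s) x‖ₑ ^ 2),
          finrank_euclideanSpace_fin]
        rfl
    _ ≤ ‖α‖ₑ ^ 2 * (ENNReal.ofReal (γ ^ 3)⁻¹ * ENNReal.ofReal (2 * K)) := by gcongr

/-- Time change of variables `t = T + T s` for lower Lebesgue integrals: `(-1, 0) ↦ (0, T)`,
`ds = T⁻¹ dt` (`T > 0`). [folklore] -/
theorem landauTail_setLIntegral_Ioo_comp_time {T : ℝ} (hT : 0 < T) (G : ℝ → ℝ≥0∞) :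
    ∫⁻ s in Ioo (-1 : ℝ) 0, G (T + T * s) = ENNReal.ofReal T⁻¹ * ∫⁻ t in Ioo 0 T, G t := by
  have hpre : (fun s : ℝ => T + T • s) ⁻¹' Ioo 0 T = Ioo (-1) 0 := by
    ext s
    simp only [mem_preimage, smul_eq_mul, mem_Ioo]
    constructor
    · rintro ⟨h1, h2⟩
      constructor <;> nlinarith
    · rintro ⟨h1, h2⟩
      constructor <;> nlinarith
  have h := setLIntegral_preimage_comp_space_affine (E := ℝ) hT T G (Ioo 0 T)
  rw [hpre] at h
  simpa only [smul_eq_mul, Module.finrank_self, pow_one] using h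

/-- **Local dissipation of the zoom.** For a classical solution on `[0, T)` which is Leray–Hopf on
`[0, T]` (unforced, `ν > 0`, `T > 0`), the zoom `w` has `∫_{-1}^0 ∫_{B₁} |∇w|²_F < ∞`: the slices
are smooth, so `∇w(s, y) = (√T/√ν)(√ν√T) ∇u(T + T s, xs + γ y)`; enlarge `B₁` to `ℝ³`, change
variables in space and time, and use `∫₀ᵀ∫ |∇u|²_F < ∞` — the Leray–Hopf weak gradient is the
classical one a.e. (`IsLerayHopfOn.lintegral_frobeniusNormSq_fderiv_of_classical`). [folklore] -/
theorem landauTail_zoom_dissipation {ν T : ℝ} (hν : 0 < ν) (hT : 0 < T)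
    {u : ℝ → EuclideanSpace ℝ (Fin 3) → EuclideanSpace ℝ (Fin 3)} {p : ℝ → EuclideanSpace ℝ (Fin 3) → ℝ}
    (hcl : IsClassicalNSSolutionOn (Ico 0 T) ν 0 u p) (hLH : IsLerayHopfOn T ν 0 (u 0) u)
    (xs : EuclideanSpace ℝ (Fin 3)) :
    ∫⁻ s in Ioo (-1 : ℝ) 0, ∫⁻ y in ball (0 : EuclideanSpace ℝ (Fin 3)) 1,
      ENNReal.ofReal (frobeniusNormSq (fderiv ℝ
        (((Real.sqrt T / Real.sqrt ν) • stPull T (Real.sqrt ν * Real.sqrt T) T xs u) s) y)) < ⊤ := by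
  have hsν : 0 < Real.sqrt ν := Real.sqrt_pos.2 hν
  have hsT : 0 < Real.sqrt T := Real.sqrt_pos.2 hT
  set α : ℝ := Real.sqrt T / Real.sqrt ν with hαdef
  set γ : ℝ := Real.sqrt ν * Real.sqrt T with hγdef
  have hγ : 0 < γ := mul_pos hsν hsT
  obtain ⟨hfin, -⟩ := IsLerayHopfOn.lintegral_frobeniusNormSq_fderiv_of_classical hcl hLH hT
  set Fu : ℝ → EuclideanSpace ℝ (Fin 3) → ℝ≥0∞ := fun t x =>
    ENNReal.ofReal (frobeniusNormSq (fderiv ℝ (u t) x)) with hFu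
  -- the rescaled integrand on `(-1, 0)`
  have hpt : ∀ s ∈ Ioo (-1 : ℝ) 0, ∀ y : EuclideanSpace ℝ (Fin 3),
      ENNReal.ofReal (frobeniusNormSq (fderiv ℝ ((α • stPull T γ T xs u) s) y)) =
        ENNReal.ofReal ((α * γ) ^ 2) * Fu (T + T * s) (xs + γ • y) := by
    intro s hs y
    have ht : T + T * s ∈ Ico 0 T := ⟨by nlinarith [hs.1], by nlinarith [hs.2]⟩
    have hdiff : Differentiable ℝ (u (T + T * s)) :=
      (hcl.contDiff_velocity ht).differentiable (by simp)
    have hd : DifferentiableAt ℝ (stPull T γ T xs u s) y := differentiable_stPull_slice hdiff y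
    rw [show (α • stPull T γ T xs u) s = α • stPull T γ T xs u s from rfl, fderiv_const_smul hd,
      fderiv_stPull, smul_smul, frobeniusNormSq_smul, ENNReal.ofReal_mul (sq_nonneg _)]
  have h1 : ∫⁻ s in Ioo (-1 : ℝ) 0, ∫⁻ y in ball (0 : EuclideanSpace ℝ (Fin 3)) 1,
      ENNReal.ofReal (frobeniusNormSq (fderiv ℝ ((α • stPull T γ T xs u) s) y)) ≤
      ENNReal.ofReal ((α * γ) ^ 2) * ENNReal.ofReal (γ ^ 3)⁻¹ *
        (ENNReal.ofReal T⁻¹ * ∫⁻ t in Ioo 0 T, ∫⁻ x, Fu t x) := by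
    calc ∫⁻ s in Ioo (-1 : ℝ) 0, ∫⁻ y in ball (0 : EuclideanSpace ℝ (Fin 3)) 1,
          ENNReal.ofReal (frobeniusNormSq (fderiv ℝ ((α • stPull T γ T xs u) s) y))
        = ∫⁻ s in Ioo (-1 : ℝ) 0, ∫⁻ y in ball (0 : EuclideanSpace ℝ (Fin 3)) 1,
            ENNReal.ofReal ((α * γ) ^ 2) * Fu (T + T * s) (xs + γ • y) := by
          refine setLIntegral_congr_fun measurableSet_Ioo fun s hs => ?_
          refine lintegral_congr fun y => ?_
          exact hpt s hs y
      _ ≤ ∫⁻ s in Ioo (-1 : ℝ) 0, ∫⁻ y, ENNReal.ofReal ((α * γ) ^ 2) * Fu (T + T * s) (xs + γ • y) :=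
          lintegral_mono fun s => setLIntegral_le_lintegral _ _
      _ = ∫⁻ s in Ioo (-1 : ℝ) 0, ENNReal.ofReal ((α * γ) ^ 2) *
            (ENNReal.ofReal (γ ^ 3)⁻¹ * ∫⁻ x, Fu (T + T * s) x) := by
          refine lintegral_congr fun s => ?_
          rw [lintegral_const_mul' _ _ ENNReal.ofReal_ne_top,
            lintegral_comp_space_affine hγ xs (Fu (T + T * s)), finrank_euclideanSpace_fin]
      _ = ENNReal.ofReal ((α * γ) ^ 2) * ENNReal.ofReal (γ ^ 3)⁻¹ *
            ∫⁻ s in Ioo (-1 : ℝ) 0, ∫⁻ x, Fu (T + T * s) x := by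
          rw [lintegral_const_mul' _ _ ENNReal.ofReal_ne_top,
            lintegral_const_mul' _ _ ENNReal.ofReal_ne_top, mul_assoc]
      _ = ENNReal.ofReal ((α * γ) ^ 2) * ENNReal.ofReal (γ ^ 3)⁻¹ *
            (ENNReal.ofReal T⁻¹ * ∫⁻ t in Ioo 0 T, ∫⁻ x, Fu t x) := by
          rw [landauTail_setLIntegral_Ioo_comp_time hT (fun t => ∫⁻ x, Fu t x)]
  refine lt_of_le_of_lt h1 ?_
  exact ENNReal.mul_lt_top (ENNReal.mul_lt_top ENNReal.ofReal_lt_top ENNReal.ofReal_lt_top)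
    (ENNReal.mul_lt_top ENNReal.ofReal_lt_top hfin.lt_top)

/-- **The zoom has a parabolic-scale Landau tail at the origin.** If
`√(T - t) • u t (xs + √(T - t) • y) → U y` as `t → T⁻` for every `y ≠ 0`, with `U` homogeneous of
degree `-1`, then the zoom `w(s, ·) = (√T/√ν) u(T + T s, xs + √ν√T ·)` satisfies
`√(-s) • w s (√(-s) • y) → ν⁻¹ • U y` as `s → 0⁻` for every `y ≠ 0`: compose with the time map
`s ↦ T + T s` (`(-∞, 0) → (-∞, T)`), use `√(T - (T + T s)) = √T √(-s)`, read the hypothesis at the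
point `√ν • y`, and use `U (√ν • y) = (√ν)⁻¹ • U y`. [folklore] -/
theorem landauTail_zoom_tail {ν T : ℝ} (hν : 0 < ν) (hT : 0 < T)
    {u : ℝ → EuclideanSpace ℝ (Fin 3) → EuclideanSpace ℝ (Fin 3)} {xs : EuclideanSpace ℝ (Fin 3)}
    {U : EuclideanSpace ℝ (Fin 3) → EuclideanSpace ℝ (Fin 3)}
    (hhom : ∀ c : ℝ, 0 < c → ∀ x : EuclideanSpace ℝ (Fin 3), U (c • x) = c⁻¹ • U x)
    (htail : ∀ y : EuclideanSpace ℝ (Fin 3), y ≠ 0 → Tendsto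
      (fun t : ℝ => Real.sqrt (T - t) • u t (xs + Real.sqrt (T - t) • y)) (𝓝[<] T) (𝓝 (U y))) :
    ∀ y : EuclideanSpace ℝ (Fin 3), y ≠ 0 → Tendsto (fun s : ℝ => Real.sqrt (0 - s) •
      ((Real.sqrt T / Real.sqrt ν) • stPull T (Real.sqrt ν * Real.sqrt T) T xs u) s (Real.sqrt (0 - s) • y))
      (𝓝[<] 0) (𝓝 (ν⁻¹ • U y)) := by
  intro y hy
  have hsν : 0 < Real.sqrt ν := Real.sqrt_pos.2 hν
  have hνν : Real.sqrt ν * Real.sqrt ν = ν := Real.mul_self_sqrt hν.le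
  have hy' : Real.sqrt ν • y ≠ 0 := smul_ne_zero hsν.ne' hy
  -- the time map `s ↦ T + T s` sends `s → 0⁻` to `t → T⁻`
  have hφ : Tendsto (fun s : ℝ => T + T * s) (𝓝[<] 0) (𝓝[<] T) := by
    refine tendsto_nhdsWithin_iff.2 ⟨?_, ?_⟩
    · have hc : Continuous fun s : ℝ => T + T * s := by fun_prop
      have h := hc.tendsto 0
      rw [mul_zero, add_zero] at h
      exact h.mono_left nhdsWithin_le_nhds
    · filter_upwards [self_mem_nhdsWithin] with s hs
      have hs' : s < 0 := hs
      show T + T * s < T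
      nlinarith
  have h2 := ((htail _ hy').comp hφ).const_smul (Real.sqrt ν)⁻¹
  have hU : (Real.sqrt ν)⁻¹ • U (Real.sqrt ν • y) = ν⁻¹ • U y := by
    rw [hhom _ hsν y, smul_smul, ← mul_inv, hνν]
  rw [hU] at h2
  refine Tendsto.congr (fun s => ?_) h2
  simp only [Function.comp_apply, smul_stPull_apply]
  have hsq : Real.sqrt (T - (T + T * s)) = Real.sqrt T * Real.sqrt (0 - s) := by
    rw [show T - (T + T * s) = T * (0 - s) by ring, Real.sqrt_mul hT.le]
  rw [hsq]
  simp only [smul_smul]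
  have e1 : (Real.sqrt ν)⁻¹ * (Real.sqrt T * Real.sqrt (0 - s)) =
      Real.sqrt (0 - s) * (Real.sqrt T / Real.sqrt ν) := by
    field_simp
  have e2 : Real.sqrt T * Real.sqrt (0 - s) * Real.sqrt ν =
      Real.sqrt ν * Real.sqrt T * Real.sqrt (0 - s) := by ring
  rw [e1, e2]

/-! ### The cut is tight -/

/-- **`LandauTailBlowup → LandauTailLocal`** (crux stmt-NavierStokesRegularity-1944 ⊢ item
stmt-NavierStokesRegularity-1946): a Clay-data classical Leray–Hopf solution with a parabolic-scale
Landau tail at `(xs, T)`, viscosity `ν`, gives — by the viscosity-normalising parabolic zoom about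
`(T, xs)` — a unit-viscosity classical solution on `ℝ³ × (-1, 0)` with Tsai's local energy bounds on
`B₁` and the Landau tail `ν⁻¹ U` (again a nonzero `(-1)`-homogeneous steady profile, now for `ν = 1`)
at the origin. [folklore] -/
theorem landauTailLocal_of_landauTailBlowup :
    Summit.NavierStokesRegularity.NavierStokesRegularity.Theses.LandauTail.LandauTailBlowup →
      Summit.NavierStokesRegularity.NavierStokesRegularity.Theses.LandauTail.LandauTailLocal := by
  intro h
  unfold Summit.NavierStokesRegularity.NavierStokesRegularity.Theses.LandauTail.LandauTailBlowup at h
  unfold Summit.NavierStokesRegularity.NavierStokesRegularity.Theses.LandauTail.LandauTailLocal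
  obtain ⟨ν, hν, T, hT, u, p, hcl, hLH, -, xs, U, P, ⟨hU, hP, hNS, hdiv, hhom, hne⟩, htail⟩ := h
  obtain ⟨hU', hP', hNS', hdiv', hhom', hne'⟩ :=
    landauTail_profile_viscosity_one hν hU hP hNS hdiv hhom hne
  obtain ⟨C, hC⟩ := landauTail_zoom_energy hν hT hLH xs
  exact ⟨_, _, fun x => ν⁻¹ • U x, fun x => (ν⁻¹) ^ 2 * P x, ⟨hU', hP', hNS', hdiv', hhom', hne'⟩,
    landauTail_zoom_isClassicalNSSolutionOn hν hT hcl xs, ⟨C, hC⟩,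
    landauTail_zoom_dissipation hν hT hcl hLH xs, landauTail_zoom_tail hν hT hhom htail⟩

/-- **`LandauTailBlowup → LandauTailTransfer`** (crux ⊢ item stmt-NavierStokesRegularity-1948): the
localisation item is by definition `(body of LandauTailLocal) → (body of LandauTailBlowup)`, so it is
implied by its own consequent. [folklore] -/
theorem landauTailTransfer_of_landauTailBlowup
    (h : Summit.NavierStokesRegularity.NavierStokesRegularity.Theses.LandauTail.LandauTailBlowup) :
    Summit.NavierStokesRegularity.NavierStokesRegularity.Theses.LandauTail.LandauTailTransfer := by
  unfold Summit.NavierStokesRegularity.NavierStokesRegularity.Theses.LandauTail.LandauTailTransfer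
  intro _
  exact h

/-- **The birth cut of the crux is tight**: `LandauTailBlowup ↔ LandauTailLocal ∧ LandauTailTransfer`
(items stmt-NavierStokesRegularity-1946 ∧ 1948 ⊣⊢ 1944). The direction `←` is modus ponens across
the definitional seam (the skeleton `Cruxes/LandauTailBlowup/Lines/birth.lean`); `→` is
`landauTailLocal_of_landauTailBlowup` and `landauTailTransfer_of_landauTailBlowup`. [folklore] -/
theorem landauTailBlowup_iff_local_and_transfer :
    Summit.NavierStokesRegularity.NavierStokesRegularity.Theses.LandauTail.LandauTailBlowup ↔
      (Summit.NavierStokesRegularity.NavierStokesRegularity.Theses.LandauTail.LandauTailLocal ∧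
        Summit.NavierStokesRegularity.NavierStokesRegularity.Theses.LandauTail.LandauTailTransfer) :=
  ⟨fun h => ⟨landauTailLocal_of_landauTailBlowup h, landauTailTransfer_of_landauTailBlowup h⟩,
    fun h => h.2 h.1⟩

/-- **A local Liouville theorem refutes the crux**: if no local-energy-class classical solution on
`ℝ³ × (-1, 0)` has a parabolic-scale Landau tail at the origin (`¬ LandauTailLocal`, the refutation of
item stmt-NavierStokesRegularity-1946 — an "asymptotic Tsai Theorem 2 with a puncture"), then no
Clay-data solution has a Landau tail anywhere (`¬ LandauTailBlowup`). [folklore] -/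
theorem not_landauTailBlowup_of_not_landauTailLocal
    (h : ¬ Summit.NavierStokesRegularity.NavierStokesRegularity.Theses.LandauTail.LandauTailLocal) :
    ¬ Summit.NavierStokesRegularity.NavierStokesRegularity.Theses.LandauTail.LandauTailBlowup :=
  fun hX => h (landauTailLocal_of_landauTailBlowup hX)

end Summit.NavierStokesRegularity.NavierStokesRegularity.Theorems

end
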